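import Summits.CriticalPhenomena.PercolationContinuityZ3.Theorems.PercNearOneGluingNoHeavyLowerTailSunflowerMultiPetalKempeMarkedCells
import HarnessLib
import HarnessLib.Audit

/-!
# `NoHeavyLowerTail` (crux stmt-CriticalPhenomena-4575), marked-multigraph layer: PATTERNS and the DEFICIT CLASSIFICATION of the
# neighbourhood-contraction cells

Support file (seat `prim-l12-p2` gen 47; `--supports stmt-CriticalPhenomena-4575`; continuation of `…KempeMarkedCells` (p595450)).  No `sorry`; nothing is
asserted about the crux.  Memo: run/shared/lean/prim/prim-l12/prim-l12-p2/FINDING-g47-NEIGHBOURHOOD-CONTRACTION-STEP.md §3 STEP 1, §6 (i).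

With `S = N(y) ∖ {u,v}` (hypothesis `hS : w ∈ S ↔ w ∉ {u,v,y} ∧ mul y w ≠ 0`), an unmarked `y ∼ u`, and a colouring `ρ` with `ρ u = 0`, `ρ v = 1`:
* `linkM_eq_outer` — the link weight of `y` splits into the `u`-term, the `v`-term and the sum over `S`; `sumS_eq_zero_iff`, `sumS_eq_one`, `card_le_sumS`,
  `profM_allZero` — the profile ↔ pattern dictionary;
* **`resCell_neg_cases`** — for `|S| ≥ 2`, a cell with NEGATIVE residual lies in one of the four families of the memo:
  D1 (`S ≡ 2`, `mul y u = 1`, `mul y v = 0`, type `(0,0,1)`), D2 (`S ≡ 1`, `mul y u = 1`, type `(0,0,1)`), D4 (`S ≡ 0` except one simply-joined `s₀ ↦ 2`,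
  `mul y v = 0`, type `(0,1,0)`), D5 (`S ≡ 0` except one simply-joined `s₀ ↦ 1`, `mul y v = 0`, type `(0,0,1)`).  (The residual there is `−1`, `kerTAbs_deficit_value`.)
The charging injections from these families to payer cells (memo §6 (ii)) are the next file.
-/

namespace Summit.CriticalPhenomena.PercolationContinuityZ3.Theorems.SunflowerPartition.Kempe

open Finset

namespace MGraph

variable {V : Type*} [Fintype V] [LinearOrder V] (K : MGraph V)

/-! ## Patterns: the profile of `y` in terms of the colouring of `S = N(y) ∖ {u,v}` -/

section Patterns

variable {K}
variable {u v y : V} {S : Finset V}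

/-- **Link decomposition**: the `c`-coloured link weight of `y` is the `u`-term, the `v`-term and the sum over `S`. [this work] -/
theorem linkM_eq_outer (hS : ∀ w, w ∈ S ↔ (w ≠ u ∧ w ≠ v ∧ w ≠ y ∧ K.mul y w ≠ 0)) (huv : u ≠ v) (hyu : y ≠ u) (hyv : y ≠ v) (ρ : V → Fin 3) (c : Fin 3) :
    K.linkM y ρ c = (if ρ u = c then K.mul y u else 0) + (if ρ v = c then K.mul y v else 0)
      + ∑ s ∈ S, (if ρ s = c then K.mul y s else 0) := by
  unfold linkM
  have huS : u ∉ S := fun h => ((hS u).1 h).1 rfl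
  have hvS : v ∉ S := fun h => ((hS v).1 h).2.1 rfl
  have hsub : ∀ w ∈ (univ : Finset V), (if ρ w = c then K.mul y w else 0) ≠ 0 → w ∈ insert u (insert v S) := by
    intro w _ hw
    rw [mem_insert, mem_insert]
    by_cases h1 : w = u
    · exact Or.inl h1
    by_cases h2 : w = v
    · exact Or.inr (Or.inl h2)
    refine Or.inr (Or.inr ((hS w).2 ⟨h1, h2, ?_, ?_⟩))
    · intro h3; subst h3; simp [K.loopless] at hw
    · intro h3; simp [h3] at hw
  rw [← sum_subset (subset_univ (insert u (insert v S))) (fun w hw hnot => by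
        by_contra hne; exact hnot (hsub w hw hne)),
    sum_insert (by rw [mem_insert]; exact fun h => h.elim huv huS), sum_insert hvS]
  ring

/-- In the all-`0` cell of a colouring with the terminal colours, the profile is `(2, [mul y v ≠ 0]-ish, 0)`: its `0`-coordinate is saturated (y ∼ u and
`S` nonempty) and its `2`-coordinate vanishes. [this work] -/
theorem profM_allZero (hS : ∀ w, w ∈ S ↔ (w ≠ u ∧ w ≠ v ∧ w ≠ y ∧ K.mul y w ≠ 0)) (huv : u ≠ v) (hyu : y ≠ u) (hyv : y ≠ v) (hmy : K.mark y = 0) (hyu' : K.mul y u ≠ 0)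
    (hne : S.Nonempty) (ρ : V → Fin 3) (hu : ρ u = 0) (hv : ρ v = 1) (hall : ∀ s ∈ S, ρ s = 0) :
    (K.profM y ρ).1 = 2 ∧ (K.profM y ρ).2.2 = 0 := by
  obtain ⟨s₀, hs₀⟩ := hne
  have hs₀' := (hS s₀).1 hs₀
  unfold profM
  simp only [hmy, add_zero]
  constructor
  · rw [linkM_eq_outer hS huv hyu hyv ρ 0, if_pos hu, if_neg (by rw [hv]; decide)]
    have hle : K.mul y s₀ ≤ ∑ s ∈ S, (if ρ s = 0 then K.mul y s else 0) := by
      have := single_le_sum (f := fun s => if ρ s = 0 then K.mul y s else 0) (fun s _ => Nat.zero_le _) hs₀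
      simpa [hall s₀ hs₀] using this
    have h1 : 1 ≤ K.mul y u := Nat.one_le_iff_ne_zero.2 hyu'
    have h2 : 1 ≤ K.mul y s₀ := Nat.one_le_iff_ne_zero.2 hs₀'.2.2.2
    unfold cap3; ext; simp; omega
  · rw [linkM_eq_outer hS huv hyu hyv ρ 2, if_neg (by rw [hu]; decide), if_neg (by rw [hv]; decide)]
    have h0 : ∑ s ∈ S, (if ρ s = 2 then K.mul y s else 0) = 0 :=
      sum_eq_zero fun s hs => by rw [hall s hs]; simp
    rw [h0]; rfl


omit [Fintype V] [LinearOrder V] in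
/-- The `S`-part of the link weight vanishes iff no member of `S` has colour `c`. [this work] -/
theorem sumS_eq_zero_iff (hS : ∀ w, w ∈ S ↔ (w ≠ u ∧ w ≠ v ∧ w ≠ y ∧ K.mul y w ≠ 0)) (ρ : V → Fin 3) (c : Fin 3) :
    (∑ s ∈ S, (if ρ s = c then K.mul y s else 0)) = 0 ↔ ∀ s ∈ S, ρ s ≠ c := by
  rw [sum_eq_zero_iff]
  constructor
  · intro h s hs hc
    have := h s hs
    rw [if_pos hc] at this
    exact ((hS s).1 hs).2.2.2 this
  · intro h s hs
    rw [if_neg (h s hs)]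

omit [Fintype V] [LinearOrder V] in
/-- If the `S`-part of the link weight is `1`, exactly one member of `S` has colour `c`, and it is simply joined to `y`. [this work] -/
theorem sumS_eq_one (hS : ∀ w, w ∈ S ↔ (w ≠ u ∧ w ≠ v ∧ w ≠ y ∧ K.mul y w ≠ 0)) (ρ : V → Fin 3) (c : Fin 3)
    (h1 : (∑ s ∈ S, (if ρ s = c then K.mul y s else 0)) = 1) :
    ∃ s₀ ∈ S, ρ s₀ = c ∧ K.mul y s₀ = 1 ∧ ∀ s ∈ S, s ≠ s₀ → ρ s ≠ c := by
  have hex : ∃ s₀ ∈ S, (if ρ s₀ = c then K.mul y s₀ else 0) ≠ 0 := by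
    by_contra hno
    push Not at hno
    rw [sum_eq_zero hno] at h1
    exact absurd h1 (by decide)
  obtain ⟨s₀, hs₀, hne⟩ := hex
  have hc₀ : ρ s₀ = c := by
    by_contra hc; rw [if_neg hc] at hne; exact hne rfl
  refine ⟨s₀, hs₀, hc₀, ?_, ?_⟩
  · have hle := single_le_sum (f := fun s => if ρ s = c then K.mul y s else 0) (fun s _ => Nat.zero_le _) hs₀
    rw [h1] at hle
    simp only [hc₀, if_true] at hle
    rw [if_pos hc₀] at hne
    omega
  · intro s hs hss hc
    have hle := add_le_sum (f := fun s => if ρ s = c then K.mul y s else 0) (fun s _ => Nat.zero_le _) hs₀ hs hss.symm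
    rw [h1] at hle
    simp only [hc₀, hc, if_true] at hle
    have a := ((hS s₀).1 hs₀).2.2.2
    have b := ((hS s).1 hs).2.2.2
    omega

omit [Fintype V] [LinearOrder V] in
/-- If every member of `S` has colour `c`, the `S`-part of the link weight is at least `|S|`. [this work] -/
theorem card_le_sumS (hS : ∀ w, w ∈ S ↔ (w ≠ u ∧ w ≠ v ∧ w ≠ y ∧ K.mul y w ≠ 0)) (ρ : V → Fin 3) (c : Fin 3) (hall : ∀ s ∈ S, ρ s = c) :
    S.card ≤ ∑ s ∈ S, (if ρ s = c then K.mul y s else 0) := by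
  rw [card_eq_sum_ones]
  refine sum_le_sum fun s hs => ?_
  rw [if_pos (hall s hs)]
  exact Nat.one_le_iff_ne_zero.2 ((hS s).1 hs).2.2.2


/-- **DEFICIT CLASSIFICATION** (memo §3 STEP 1, |S| ≥ 2): a cell with negative residual is in one of the four families
D1 (S ≡ 2, type 001), D2 (S ≡ 1, type 001), D4 (S ≡ 0 but one simply-joined 2, type 010), D5 (S ≡ 0 but one simply-joined 1, type 001),
with the flag conditions (y–u simple for D1/D2, y ≁ v for D1/D4/D5). [this work] -/
theorem resCell_neg_cases (hS : ∀ w, w ∈ S ↔ (w ≠ u ∧ w ≠ v ∧ w ≠ y ∧ K.mul y w ≠ 0)) (huv : u ≠ v) (hyu : y ≠ u) (hyv : y ≠ v) (hmy : K.mark y = 0) (hyu' : K.mul y u ≠ 0)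
    (htwo : 2 ≤ S.card) (ρ : V → Fin 3) (hu : ρ u = 0) (hv : ρ v = 1) (hneg : K.resCell y S ρ < 0) :
    ((∀ s ∈ S, ρ s = 2) ∧ K.mul y u = 1 ∧ K.mul y v = 0 ∧ (K.isolate y).ctypeM ρ = (0, 0, 1)) ∨
    ((∀ s ∈ S, ρ s = 1) ∧ K.mul y u = 1 ∧ (K.isolate y).ctypeM ρ = (0, 0, 1)) ∨
    (∃ s₀ ∈ S, ρ s₀ = 2 ∧ K.mul y s₀ = 1 ∧ (∀ s ∈ S, s ≠ s₀ → ρ s = 0) ∧ K.mul y v = 0 ∧ (K.isolate y).ctypeM ρ = (0, 1, 0)) ∨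
    (∃ s₀ ∈ S, ρ s₀ = 1 ∧ K.mul y s₀ = 1 ∧ (∀ s ∈ S, s ≠ s₀ → ρ s = 0) ∧ K.mul y v = 0 ∧ (K.isolate y).ctypeM ρ = (0, 0, 1)) := by
  have hne : S.Nonempty := card_pos.1 (by omega)
  -- the profile in terms of the S-sums
  set A0 := ∑ s ∈ S, (if ρ s = 0 then K.mul y s else 0) with hA0
  set A1 := ∑ s ∈ S, (if ρ s = 1 then K.mul y s else 0) with hA1
  set A2 := ∑ s ∈ S, (if ρ s = 2 then K.mul y s else 0) with hA2
  have hk : K.profM y ρ = (cap3 (K.mul y u + A0), cap3 (K.mul y v + A1), cap3 A2) := by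
    unfold profM
    rw [linkM_eq_outer hS huv hyu hyv ρ 0, linkM_eq_outer hS huv hyu hyv ρ 1, linkM_eq_outer hS huv hyu hyv ρ 2,
      hu, hv, hmy]
    simp
    exact ⟨rfl, rfl, rfl⟩
  have hk1 : (K.profM y ρ).1 ≠ 0 := by
    rw [hk]; simp only; intro h; have := (eq_zero_iff_cap3 _).2 h; omega
  -- negativity forces a defect profile (contrapositive of resCell_nonneg_of_profile)
  have hallA_prof : (∀ s ∈ S, ρ s = 0) → (K.profM y ρ).1 = 2 ∧ (K.profM y ρ).2.2 = 0 :=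
    fun hall => profM_allZero hS huv hyu hyv hmy hyu' hne ρ hu hv hall
  have h200 : K.profM y ρ = (2, 0, 0) → ∀ s ∈ S, ρ s = 0 := by
    intro h s hs
    rw [hk] at h
    simp only [Prod.mk.injEq] at h
    have hb : K.mul y v + A1 = 0 := (eq_zero_iff_cap3 _).2 h.2.1
    have hc : A2 = 0 := (eq_zero_iff_cap3 _).2 h.2.2
    have hb' : A1 = 0 := by omega
    have n1 := (sumS_eq_zero_iff hS ρ 1).1 hb' s hs
    have n2 := (sumS_eq_zero_iff hS ρ 2).1 hc s hs
    -- Fin 3 trichotomy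
    have : ∀ z : Fin 3, z ≠ 1 → z ≠ 2 → z = 0 := by decide
    exact this _ n1 n2
  have hdef : ¬(K.profM y ρ ≠ (1, 0, 0) ∧ K.profM y ρ ≠ (1, 0, 1) ∧ K.profM y ρ ≠ (1, 1, 0) ∧ K.profM y ρ ≠ (1, 0, 2) ∧
      K.profM y ρ ≠ (1, 2, 0) ∧ K.profM y ρ ≠ (2, 0, 1) ∧ K.profM y ρ ≠ (2, 1, 0)) := by
    intro hk7
    exact absurd (resCell_nonneg_of_profile K y S ρ hk1 hk7 h200 hallA_prof) (not_le.2 hneg)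
  -- helper facts
  have tri0 : ∀ z : Fin 3, z ≠ 1 → z ≠ 2 → z = 0 := by decide
  have tri1 : ∀ z : Fin 3, z ≠ 0 → z ≠ 2 → z = 1 := by decide
  have tri2 : ∀ z : Fin 3, z ≠ 0 → z ≠ 1 → z = 2 := by decide
  have hmu : 1 ≤ K.mul y u := Nat.one_le_iff_ne_zero.2 hyu'
  -- unpack which of the seven profiles holds
  simp only [not_and_or, not_not] at hdef
  -- in all seven cases the cell is not all-0, so resCell = kerTAbs
  have resEq : ¬(∀ s ∈ S, ρ s = 0) → K.resCell y S ρ = kerTAbs ((K.isolate y).ctypeM ρ) (K.profM y ρ) := by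
    intro h; unfold resCell; rw [if_neg h, sub_zero]
  rcases hdef with h | h | h | h | h | h | h
  · -- (1,0,0): A0 = 0, A1 = 0, A2 = 0 ⇒ S empty-coloured: impossible
    exfalso
    rw [hk] at h; simp only [Prod.mk.injEq] at h
    have e0 : K.mul y u + A0 = 1 := (eq_one_iff_cap3 _).2 h.1
    have e2 : A2 = 0 := (eq_zero_iff_cap3 _).2 h.2.2
    have e1 : K.mul y v + A1 = 0 := (eq_zero_iff_cap3 _).2 h.2.1
    have a0 : A0 = 0 := by omega
    obtain ⟨s, hs⟩ := hne
    have n0 := (sumS_eq_zero_iff hS ρ 0).1 a0 s hs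
    have n1 := (sumS_eq_zero_iff hS ρ 1).1 (by omega) s hs
    have n2 := (sumS_eq_zero_iff hS ρ 2).1 e2 s hs
    exact n0 (tri0 _ n1 n2)
  · -- (1,0,1): exactly one 2, no 0, no 1 ⇒ |S| = 1: impossible
    exfalso
    rw [hk] at h; simp only [Prod.mk.injEq] at h
    have e0 : K.mul y u + A0 = 1 := (eq_one_iff_cap3 _).2 h.1
    have e1 : K.mul y v + A1 = 0 := (eq_zero_iff_cap3 _).2 h.2.1
    have e2 : A2 = 1 := (eq_one_iff_cap3 _).2 h.2.2
    obtain ⟨s₀, hs₀, hc₀, -, huniq⟩ := sumS_eq_one hS ρ 2 e2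
    have n0 := (sumS_eq_zero_iff hS ρ 0).1 (by omega)
    have n1 := (sumS_eq_zero_iff hS ρ 1).1 (by omega)
    -- every s ∈ S is coloured 2, hence equals s₀; so S = {s₀}, contradicting |S| ≥ 2
    have hall2 : ∀ s ∈ S, s = s₀ := fun s hs => by
      by_contra hss; exact huniq s hs hss (tri2 _ (n0 s hs) (n1 s hs))
    have : S.card ≤ 1 := card_le_one.2 fun a ha b hb => by rw [hall2 a ha, hall2 b hb]
    omega
  · -- (1,1,0): no 0, no 2, so S ≡ 1 and A1 ≥ |S| ≥ 2: contradicts cap = 1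
    exfalso
    rw [hk] at h; simp only [Prod.mk.injEq] at h
    have e0 : K.mul y u + A0 = 1 := (eq_one_iff_cap3 _).2 h.1
    have e1 : K.mul y v + A1 = 1 := (eq_one_iff_cap3 _).2 h.2.1
    have e2 : A2 = 0 := (eq_zero_iff_cap3 _).2 h.2.2
    have n0 := (sumS_eq_zero_iff hS ρ 0).1 (by omega)
    have n2 := (sumS_eq_zero_iff hS ρ 2).1 e2
    have hall1 : ∀ s ∈ S, ρ s = 1 := fun s hs => tri1 _ (n0 s hs) (n2 s hs)
    have := card_le_sumS hS ρ 1 hall1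
    omega
  · -- (1,0,2): D1
    left
    rw [hk] at h; simp only [Prod.mk.injEq] at h
    have e0 : K.mul y u + A0 = 1 := (eq_one_iff_cap3 _).2 h.1
    have e1 : K.mul y v + A1 = 0 := (eq_zero_iff_cap3 _).2 h.2.1
    have n0 := (sumS_eq_zero_iff hS ρ 0).1 (by omega)
    have n1 := (sumS_eq_zero_iff hS ρ 1).1 (by omega)
    have hall2 : ∀ s ∈ S, ρ s = 2 := fun s hs => tri2 _ (n0 s hs) (n1 s hs)
    have hnot : ¬(∀ s ∈ S, ρ s = 0) := by
      obtain ⟨s, hs⟩ := hne; intro hh; have := hh s hs; rw [hall2 s hs] at this; exact absurd this (by decide)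
    have hker : kerTAbs ((K.isolate y).ctypeM ρ) (1, 0, 2) < 0 := by
      have := resEq hnot; rw [this, hk, h.1, h.2.1, h.2.2] at hneg; exact hneg
    refine ⟨hall2, by omega, by omega, ((kerTAbs_deficit_value _).1.2).1 hker⟩
  · -- (1,2,0): D2
    right; left
    rw [hk] at h; simp only [Prod.mk.injEq] at h
    have e0 : K.mul y u + A0 = 1 := (eq_one_iff_cap3 _).2 h.1
    have e2 : A2 = 0 := (eq_zero_iff_cap3 _).2 h.2.2
    have n0 := (sumS_eq_zero_iff hS ρ 0).1 (by omega)
    have n2 := (sumS_eq_zero_iff hS ρ 2).1 e2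
    have hall1 : ∀ s ∈ S, ρ s = 1 := fun s hs => tri1 _ (n0 s hs) (n2 s hs)
    have hnot : ¬(∀ s ∈ S, ρ s = 0) := by
      obtain ⟨s, hs⟩ := hne; intro hh; have := hh s hs; rw [hall1 s hs] at this; exact absurd this (by decide)
    have hker : kerTAbs ((K.isolate y).ctypeM ρ) (1, 2, 0) < 0 := by
      have := resEq hnot; rw [this, hk, h.1, h.2.1, h.2.2] at hneg; exact hneg
    refine ⟨hall1, by omega, ((kerTAbs_deficit_value _).2.1.2).1 hker⟩
  · -- (2,0,1): D4
    right; right; left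
    rw [hk] at h; simp only [Prod.mk.injEq] at h
    have e1 : K.mul y v + A1 = 0 := (eq_zero_iff_cap3 _).2 h.2.1
    have e2 : A2 = 1 := (eq_one_iff_cap3 _).2 h.2.2
    obtain ⟨s₀, hs₀, hc₀, hm₀, huniq⟩ := sumS_eq_one hS ρ 2 e2
    have n1 := (sumS_eq_zero_iff hS ρ 1).1 (by omega)
    have hrest : ∀ s ∈ S, s ≠ s₀ → ρ s = 0 := fun s hs hss => tri0 _ (n1 s hs) (huniq s hs hss)
    have hnot : ¬(∀ s ∈ S, ρ s = 0) := fun hh => by have := hh s₀ hs₀; rw [hc₀] at this; exact absurd this (by decide)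
    have hker : kerTAbs ((K.isolate y).ctypeM ρ) (2, 0, 1) < 0 := by
      have := resEq hnot; rw [this, hk, h.1, h.2.1, h.2.2] at hneg; exact hneg
    exact ⟨s₀, hs₀, hc₀, hm₀, hrest, by omega, ((kerTAbs_deficit_value _).2.2.1.2).1 hker⟩
  · -- (2,1,0): D5 (the all-0 sub-case is excluded by the all-0 table)
    right; right; right
    rw [hk] at h; simp only [Prod.mk.injEq] at h
    have e1 : K.mul y v + A1 = 1 := (eq_one_iff_cap3 _).2 h.2.1
    have e2 : A2 = 0 := (eq_zero_iff_cap3 _).2 h.2.2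
    have n2 := (sumS_eq_zero_iff hS ρ 2).1 e2
    by_cases hallA : ∀ s ∈ S, ρ s = 0
    · exfalso
      have : 0 ≤ K.resCell y S ρ := by
        unfold resCell; rw [if_pos hallA, hk, h.1, h.2.1, h.2.2]; exact kerTAbs_sub_fC_nonneg_of_all_zero _ 1
      exact absurd this (not_le.2 hneg)
    · have hA1 : A1 = 1 := by
        rcases Nat.eq_zero_or_pos (K.mul y v) with hv0 | hvpos
        · omega
        · exfalso
          have a1 : A1 = 0 := by omega
          have n1 := (sumS_eq_zero_iff hS ρ 1).1 a1
          exact hallA fun s hs => tri0 _ (n1 s hs) (n2 s hs)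
      obtain ⟨s₀, hs₀, hc₀, hm₀, huniq⟩ := sumS_eq_one hS ρ 1 hA1
      have hrest : ∀ s ∈ S, s ≠ s₀ → ρ s = 0 := fun s hs hss => tri0 _ (huniq s hs hss) (n2 s hs)
      have hker : kerTAbs ((K.isolate y).ctypeM ρ) (2, 1, 0) < 0 := by
        have := resEq hallA; rw [this, hk, h.1, h.2.1, h.2.2] at hneg; exact hneg
      exact ⟨s₀, hs₀, hc₀, hm₀, hrest, by omega, ((kerTAbs_deficit_value _).2.2.2.2).1 hker⟩

end Patterns

end MGraph

end Summit.CriticalPhenomena.PercolationContinuityZ3.Theorems.SunflowerPartition.Kempe
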